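import Summits.BirchSwinnertonDyer.Rank1Residual.Additive.RamifiedSevenGenusKummerColumnData
import Summits.BirchSwinnertonDyer.Rank1Residual.Additive.RamifiedSevenGenusMemberType
import Summits.BirchSwinnertonDyer.Rank1Residual.Additive.RamifiedSevenGenusStarColumn
import HarnessLib

set_option autoImplicit false

/-!
# `𝒞₇` genus road (crux `EllipticUnitValueSevenOfGZK`, K7r), row K2C-16: THE FRAME CONSTRUCTOR `katoGenusFrameOf` —
# a `GenusSeven.PinnedKatoGenusFrame W K hK I d` for every `W ∈ 𝒞₇`, every cyclotomic datum, every genus frame of the member and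
# every genus datum over the normed elliptic family, with the FRAME-LEMMA field `EU_not_mem_of_residue` FILLED by Road I

Cell bsd-cm, seat bsd-cm-prr-ty1 g36 (literature-prover); row card `bsd-cm-plan/g37/SUMMON-typers-K2C-13-16.md` (K2C-16); design CHECK STATUS
l.4199 and pen GO D1098 (Q1)–(Q4); duties D1062 (ι₀ := the complex place, ιC := `algClosureEmb ι₀`), D1069/D1089 ((H_θ)/(H_η)/(H_e), hHU/hVH/hx),
D1074 (ONE `φ` feeds `Φ.φ` and the good `γ₂`), D1085 (a2) (`Φ.a := memberType W`), D1095 (K16-gap).  DEFINITIONS (review lane): the selector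
`kummerColumnDataOf` of the record `KummerColumnData` (sibling `RamifiedSevenGenusKummerColumnData.lean` (K16-c1): the record, `normedFamilyOf`, and
the K16-gap theorem `EU_not_mem_of_residue_of_kummerColumn`) and ★★★ `katoGenusFrameOf`, + `rfl` junction theorems; no named fact, no `instance`
declaration (instance-typed record fields are bound with `haveI` in terms), no notation, no `sorry`.  CONDITIONAL on the DISPLAYED named facts ★ `exists_zetaClassPosition_of_rank_le_one`, GZK, `h159′`, Kato §15.5 (`hE`, `h155u`),
de Shalit II.2.5 (i)/II.2.4 (i), (M1)/(M1′), Gross (8.2.7) (`hG`) — all EXISTING — and on the displayed (H_η) pin `hη` ((S-η) until the F-η bridge).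

WHAT `katoGenusFrameOf` IS (fields; module docstring of `RamifiedSevenGenusKatoPinnedFrame.lean` for their meaning).  INPUTS AS PARAMETERS (so that
`Φ.Kcm = Kcm`, `Φ.IK = IK`, `Φ.φ = φ`, `Φ.𝔞 = 𝔞`, `Φ.ιC = algClosureEmb ι₀`, `Φ.𝔣 = (s)·(|D|)`, `Φ.a = memberType W` hold by `rfl` — §6): the CM
field block `(Kcm, s ∈ O_K, c, ι₀, e : K̄ → ℚ̄)`, the `K`-side carriers `(γK, IK)` and the CM isogeny `φ` ((C1) `CarrierAlgebra.exists_carrier_inputs`,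
`CMIsogeny.exists_cmIsogeny_sq_eq_neg_seven_of_classCSeven` inhabit them), the twist `𝔞` and the representatives `z n` of `_𝔞z_{7^{n+1}𝔣}`.
CARRIERS = (C1) verbatim (`R := Λ[ϖ]/(ϖ²+7)`, `A := IK.H[1/7]`, `ιS := x ↦ x/1`, `HS := range toRat`, `j := ιS ∘ resOver`).  ★-COLUMN = (C2)'s
`(zOne, k)` (★ + GZK) PLACED per (a2): `a := memberType W`, `u := 1`, `t := 1`, `zS := zeta := (−ϖ)^a • res(zOne)/7^{k+a}`
(`j_zOne_of_memberType`).  ELLIPTIC-UNIT COLUMN = the KUMMER column of K2C-8 G on a GOOD `γ₂` (`ψ`, `Ω`, `𝔏`, `euK`; `EU 𝔟 := ιS (euK 𝔟)`,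
`EU_eq := rfl`).  `x := 0` (the unpinned position element of `Frame1516`; no reader — D1098 (Q3)).  ★★ K16-GAP: `EU_not_mem_of_residue := fun hres ↦`
(K3)'s conversion ∘ T3a `not_mem_range_isogenyMap_of_ne_zero` ∘ L6 `kummerNonvanishing_of_genusResidue` with (H_e) = the good `γ₂`, `hx` = the Kummer
column's layer identity, `hHU`/`hVH` = (K3), (H_θ) = p817965 over `normedFamilyOf_reading`, and (H_η) = the displayed `hη`.

HONEST LABEL: a CONSTRUCTOR over displayed research inputs; it proves nothing about Kato's zeta values, `exp*` or `L`-values; (S-D) `∃ D :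
KatoExpPadicDatum hγ (katoGenusFrameOf …)`, (S-★), PR^×, hR3c, (S-η) are exactly as open as before; no stub closes here; stmt-BirchSwinnertonDyer-19945
OPEN; K2ᶜ-inhabitation is NOT done by this file alone; `X12.CMRamifiedSeven` NOT proved; no summit statement is proved by this seat; BSD claimed for no curve.

## References
* K. Kato, Astérisque 295 (2004), Prop. 15.9/(15.9.1) (pp. 258–259), §15.11 (pp. 260–262), (15.12.1) (p. 262), 15.14 (p. 264), (15.16.1) (p. 265),
  Thm. 12.4 (2)/12.5 (1) (pp. 221–222), §15.5 (p. 253). [Kato2004Asterisque]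
* E. de Shalit (1987), II.1.6, II.2.4, II.2.5 (i). [deShalit1987]
* B. H. Gross, LNM 776 (1980), §8.2 (8.2.7), Thm. 13.1.2 (p. 38), §24.1 (p. 82). [Gross1980]
* T. Tsuji, J. Number Theory 78 (1999), Thm 3.1. [Tsuji1999]
* Tree: (C1) p798180, (C2) p798933, G p811857 + GoodGamma p811963, L6 p816204, T3a `Kato2004/EllipticUnitKummerCupClass.lean`, F∃-2b p810359,
  K2C-15 p817832 + p817965, (K3) `RamifiedSevenGenusFrameConstructorInputs.lean`, (K4) `RamifiedSevenGenusMemberType.lean`; g29 certificate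
  `Cruxes/EllipticUnitValueSevenOfGZK/K2C6FrameCertificate_g29.lean`.
-/

noncomputable section

open scoped NumberField TensorProduct
open WeierstrassCurve Field NumberField IsDedekindDomain
open Literature.NumberTheory.IwasawaTheory
open Literature.NumberTheory.GaloisRepresentations Literature.NumberTheory.GaloisRepresentations.LocalWeilDatum
open Literature.NumberTheory.EllipticCurves
open Literature.NumberTheory.EllipticCurves.Rank1Residual
open Literature.NumberTheory.EllipticCurves.IwasawaAlgebra
open Literature.NumberTheory.EllipticCurves.Kato2004
open Literature.NumberTheory.ComplexMultiplication.EllipticUnits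
open Summit.BirchSwinnertonDyer.Rank1Residual

namespace Summit.BirchSwinnertonDyer.Rank1Residual.Additive.GenusSeven

/-! ## §5 ★★★ The constructor (§1–§4: `RamifiedSevenGenusKummerColumnData.lean`) -/

section Constructor

variable
  -- the named facts (all EXISTING tree declarations; nothing asserted)
  (hstar : exists_zetaClassPosition_of_rank_le_one) (hGZK : rank_eq_analyticRank_of_analyticRank_le_one)
  (h159' : CM.prop159_kummerCup_expStar_values)
  (hE : Literature.NumberTheory.ComplexMultiplication.EllipticUnits.Kato2004.sec155_exists_katoUnitRep)
  (h25 : DeShalit1987.prop25_i_normRelation) (h24i : DeShalit1987.prop24_i_mem_rayClassField)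
  (hM1 : CM.rayClassField_le_torsionField) (hM1' : CM.torsionField_le_rayClassField_of_conductor)
  (hG : Gross_conductorExponent_baseChange_eq_two_mul) (h155u : Kato2004.kato155_isUnit_of_two_le_primeDivisors)
  -- the member and the cyclotomic datum
  {W : WeierstrassCurve ℚ} [W.IsElliptic] [W.IsGloballyMinimal] [Fact (Nat.Prime 7)] (hC : X12.ClassCSeven W)
  [ContinuousSMul ℤ_[7] (W.tateModule 7)] (K : ZpExtension ℚ 7) (hK : K.IsCyclotomic)
  {γ : absoluteGaloisGroup ℚ} (hγ : K.IsTopGenerator γ) (I : IwasawaH1Data W 7 K γ)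
  -- the genus frame OF THE MEMBER
  (F : GenusFrame) (hbad : ∀ (q : ℕ) [Fact q.Prime], q ≠ 7 → (¬ Good W q ↔ q ∣ F.d))
  -- the CM field block
  (Kcm : Type) [Field Kcm] [NumberField Kcm] (h2 : Module.finrank ℚ Kcm = 2) (s : 𝓞 Kcm) (hs : (s : Kcm) ^ 2 = -7)
  (c : Kcm ≃ₐ[ℚ] Kcm) (hc : c ≠ 1) (ι₀ : Kcm →+* ℂ) (hι₀ : ∀ (w : InfinitePlace Kcm) (x : Kcm), ι₀ x = w.embedding x)
  (e : AlgebraicClosure Kcm →+* AlgebraicClosure ℚ)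
  -- the `K`-side carriers and the CM isogeny
  [ContinuousSMul ℤ_[7] ((W.baseChange Kcm).tateModule 7)]
  (γK : absoluteGaloisGroup Kcm) (hγK : (K.restrictOfFinrankEqTwo (by decide) Kcm h2).IsTopGenerator γK)
  (IK : IwasawaH1DataOver (W.baseChange Kcm) 7 (K.restrictOfFinrankEqTwo (by decide) Kcm h2) γK)
  (φ : Isogeny (W.baseChange Kcm) (W.baseChange Kcm)) (hφ : ∀ P, φ (φ P) = (-7 : ℤ) • P)
  -- the twist and the representatives of Kato's units at the levels `7^{n+1}𝔣`
  (𝔞 : Ideal (𝓞 Kcm)) (h𝔞 : IsTwist 7 (Ideal.span {s} * Ideal.span {((F.d : ℕ) : 𝓞 Kcm)}) 𝔞)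
  (hN𝔞 : Ideal.absNorm 𝔞 = F.normA) (z : ℕ → (AlgebraicClosure Kcm)ˣ)
  (hz : ∀ n : ℕ, IsKatoUnitRep 7 ι₀ (Ideal.span {s} * Ideal.span {((F.d : ℕ) : 𝓞 Kcm)}) (n + 1) 𝔞 (z n))
  -- (H_η): the torsion character pin, DISPLAYED ((S-η) until the F-η bridge `hEta_of_gross1312` lands)
  (hη : ∀ (g₁ : geomTorsion (W.baseChange Kcm) ((7 : ℤ) ^ 1) →+ geomTorsion (W.baseChange Kcm) ((7 : ℤ) ^ 1)),
    (∀ P, ((g₁ P : geomTorsion (W.baseChange Kcm) ((7 : ℤ) ^ 1)) : geomPoints (W.baseChange Kcm)) =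
      φ (P : geomPoints (W.baseChange Kcm))) →
    ∀ (σ : absoluteGaloisGroup Kcm) (a : ℕ) (ζ' : AlgebraicClosure Kcm), e ζ' = F.ζsys 0 → σ • ζ' = ζ' ^ a →
      ∀ P : geomTorsion (W.baseChange Kcm) ((7 : ℤ) ^ 1), g₁ P = 0 →
        σ • (P : geomPoints (W.baseChange Kcm)) =
          ((PadicInt.toZMod ((F.χD (a : ZMod F.d)) * (F.ω (a : ZMod 7)) ^ 5)).val : ℤ) • (P : geomPoints (W.baseChange Kcm)))

/-- **The Kummer column of the constructor** (a CHOICE of the record, over the constructor's inputs: `d := F.d`, `𝔣 := (s)·(|D|)`, the ONE `φ`).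
[cite: Kato2004Asterisque, (15.6.1) (p. 253), Prop. 15.9 (pp. 258–259)] -/
def kummerColumnDataOf : KummerColumnData W Kcm h2 K IK ι₀ (Ideal.span {s} * Ideal.span {((F.d : ℕ) : 𝓞 Kcm)}) F.d φ :=
  Classical.choice (nonempty_kummerColumnData h159' hE h25 h24i hM1 hM1' hG hC hbad F.odd_d Kcm h2 (s : Kcm) hs c hc ι₀ hι₀ K hK IK
    (Ideal.span {s} * Ideal.span {((F.d : ℕ) : 𝓞 Kcm)}) (absNorm_span_sqrt_mul_span_natCast h2 s hs F.d)
    (span_sqrt_mul_span_natCast_dvd_span_seven_mul s hs F.d) φ hφ)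

/-- ★★★ **`katoGenusFrameOf` — THE PINNED KATO-SIDE FRAME OF A `𝒞₇` MEMBER** over a cyclotomic datum `(K, hK, γ, I)`, a genus frame `F` of the
member (`hbad`), the CM field block, the `K`-side carriers `(γK, IK, φ)`, an admissible twist `𝔞` of norm `F.normA`, representatives `z` of
`_𝔞z_{7^{n+1}𝔣}`, and a genus datum `d` over `normedFamilyOf`; fields as in the module docstring (carriers (C1), ★-column (C2) placed with
`a := memberType W`, Kummer elliptic-unit column, K16-gap filled by `EU_not_mem_of_residue_of_kummerColumn`).  Displayed research inputs: the ten
named facts and (H_η).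
[cite: Kato2004Asterisque, Prop. 15.9 (15.9.1) (pp. 258–259), (15.11.2)–(15.11.3) (pp. 260–262), (15.12.1) (p. 262), 15.14 (p. 264), (15.16.1) (p. 265), Thm. 12.5 (1) (p. 221)]
[cite: NeukirchSchmidtWingberg2008, I §6 (Shapiro)] -/
def katoGenusFrameOf (d : GenusDatum F (normedFamilyOf F Kcm h2 s hs ι₀ e 𝔞 h𝔞 hN𝔞 z hz h155u)) :
    PinnedKatoGenusFrame W K hK I d :=
  letI instR : Module (QuadOrder (IwasawaAlgebra 7) (-7)) IK.ratH := IK.cmModuleRat hγK φ hφ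
  letI := IK.cmModule hγK φ hφ
  let D := kummerColumnDataOf h159' hE h25 h24i hM1 hM1' hG hC K hK F hbad Kcm h2 s hs c hc ι₀ hι₀ γK IK φ hφ
  let hSC := StarColumn.exists_zetaClassPosition_of_classCSeven hstar hGZK W hC hK hγ I
  let zOne : I.H := hSC.choose
  let k : ℕ := hSC.choose_spec.choose
  { Kcm := Kcm
    finrank_Kcm := h2
    sqrtNegSeven := (s : Kcm)
    sqrtNegSeven_sq := hs
    𝔣 := Ideal.span {s} * Ideal.span {((F.d : ℕ) : 𝓞 Kcm)}
    absNorm_𝔣 := absNorm_span_sqrt_mul_span_natCast h2 s hs F.d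
    𝔣_dvd := span_sqrt_mul_span_natAbs_dvd s hs F.D
    𝔞 := 𝔞
    isTwist_𝔞 := h𝔞
    absNorm_𝔞 := hN𝔞
    R := QuadOrder (IwasawaAlgebra 7) (-7)
    π := QuadOrder.ϖ
    v := -1
    seven_eq := CarrierAlgebra.seven_eq
    A := IK.ratH
    instModule := IK.cmModuleRat hγK φ hφ
    instTower := CarrierAlgebra.isScalarTower h2 W K IK hγK φ hφ
    torsionFree_π := CarrierAlgebra.torsionFree_π h2 W K IK hγK φ hφ
    frame :=
      { HS := LinearMap.range (IK.toRat hγK φ hφ)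
        zeta := (-QuadOrder.ϖ : QuadOrder (IwasawaAlgebra 7) (-7)) ^ memberType W •
            (LocalizedModule.mk (I.resOver IK hγ hγK zOne)
              (⟨(7 : IwasawaAlgebra 7) ^ (k + memberType W), k + memberType W, rfl⟩ : Submonoid.powers (7 : IwasawaAlgebra 7)) :
                IK.ratH)
        -- `x` is the unpinned position element of `Frame1516`; it has no reader (D1098 (Q3)); `KatoExpPadicDatum.xTilde` stands in for it
        x := 0
        EU := fun 𝔟 ↦ LocalizedModule.mkLinearMap (Submonoid.powers (7 : IwasawaAlgebra 7)) IK.H (D.euK 𝔟)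
        EU_mem := fun 𝔟 ↦ CarrierAlgebra.ιS_mem h2 W K IK hγK φ hφ (D.euK 𝔟) }
    j := LocalizedModule.mkLinearMap (Submonoid.powers (7 : IwasawaAlgebra 7)) IK.H ∘ₗ I.resOver IK hγ hγK
    j_mem := CarrierAlgebra.j_mem h2 W K I hγ IK hγK φ hφ
    zS := (-QuadOrder.ϖ : QuadOrder (IwasawaAlgebra 7) (-7)) ^ memberType W •
        (LocalizedModule.mk (I.resOver IK hγ hγK zOne)
          (⟨(7 : IwasawaAlgebra 7) ^ (k + memberType W), k + memberType W, rfl⟩ : Submonoid.powers (7 : IwasawaAlgebra 7)) : IK.ratH)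
    u := 1
    a := memberType W
    a_le_one := memberType_le_one W
    t := 1
    zeta_eq := twistedZS_eq_one_smul h2 W K I hγ IK hγK φ hφ zOne k (memberType W)
    zOne := zOne
    k := k
    zOne_pos := hSC.choose_spec.choose_spec
    j_zOne := j_zOne_of_memberType h2 W K I hγ IK hγK φ hφ zOne k (memberType W)
    EU_not_mem_of_residue :=
      EU_not_mem_of_residue_of_kummerColumn h25 hM1 hM1' h155u K hK F Kcm h2 s hs ι₀ e hγK IK φ hφ 𝔞 h𝔞 hN𝔞 z hz hη D d
    bad_iff_dvd := hbad
    γK := γK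
    isTopGenerator_γK := hγK
    IK := IK
    ιS := LocalizedModule.mkLinearMap (Submonoid.powers (7 : IwasawaAlgebra 7)) IK.H
    ιS_injective := CarrierAlgebra.ιS_injective h2 W K IK
    mem_HS_iff := CarrierAlgebra.mem_HS_iff h2 W K IK hγK φ hφ
    j_eq := CarrierAlgebra.j_eq h2 W K I hγ IK hγK
    φ := φ
    φ_sq := hφ
    proj_pi := CarrierAlgebra.proj_pi h2 W K IK hγK φ hφ
    ψ := D.ψ
    ψ_infinityType := D.ψ_infinityType
    ψ_LSeries := D.ψ_LSeries
    ιC := algClosureEmb ι₀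
    ιC_infinitePlace := fun w x ↦ by rw [algClosureEmb_algebraMap, hι₀ w x]
    ψ_conductor := D.ψ_conductor
    Ω := D.Ω
    Ω_ne_zero := D.Ω_ne_zero
    𝔏 := D.𝔏
    isRayClassLayer_layer := NumberFieldColumn.isRayClassLayer_layer_baseChange h2 K hK W F.d
    euK := D.euK
    euK_spec := fun 𝔟 h𝔟 ↦ by
      haveI := D.isElliptic_W₂
      haveI := D.continuousSMul_W₂
      obtain ⟨uu, -, ⟨y, hy⟩, hproj⟩ := D.column 𝔟 h𝔟
      exact ⟨_, y, hy, hproj⟩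
    EU_eq := fun _ _ ↦ rfl }

/-! ## §6 Junction identities (`rfl`): the constructor's frame HAS the input carriers and the (a2) placement -/

variable (d : GenusDatum F (normedFamilyOf F Kcm h2 s hs ι₀ e 𝔞 h𝔞 hN𝔞 z hz h155u))

/-- `Φ.a = memberType W` (D1085 (a2): the construction does NOT inherit `a := 0` from (C2)). [cite: Kato2004Asterisque, §15.11 (2) (pp. 261–262)] -/
theorem katoGenusFrameOf_a :
    (katoGenusFrameOf hstar hGZK h159' hE h25 h24i hM1 hM1' hG h155u hC K hK hγ I F hbad Kcm h2 s hs c hc ι₀ hι₀ e γK hγK IK φ hφ 𝔞 h𝔞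
      hN𝔞 z hz hη d).a = memberType W := rfl

/-- `Φ.Kcm = Kcm`. [cite: Kato2004Asterisque, 15.14 (p. 264)] -/
theorem katoGenusFrameOf_Kcm :
    (katoGenusFrameOf hstar hGZK h159' hE h25 h24i hM1 hM1' hG h155u hC K hK hγ I F hbad Kcm h2 s hs c hc ι₀ hι₀ e γK hγK IK φ hφ 𝔞 h𝔞
      hN𝔞 z hz hη d).Kcm = Kcm := rfl

/-- `Φ.𝔞 = 𝔞`. [cite: Kato2004Asterisque, §15.5 (p. 253)] -/
theorem katoGenusFrameOf_𝔞 :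
    (katoGenusFrameOf hstar hGZK h159' hE h25 h24i hM1 hM1' hG h155u hC K hK hγ I F hbad Kcm h2 s hs c hc ι₀ hι₀ e γK hγK IK φ hφ 𝔞 h𝔞
      hN𝔞 z hz hη d).𝔞 = 𝔞 := rfl

/-- `Φ.𝔣 = (s)·(|D|)`. [cite: Kato2004Asterisque, §15.8 (p. 257)] -/
theorem katoGenusFrameOf_𝔣 :
    (katoGenusFrameOf hstar hGZK h159' hE h25 h24i hM1 hM1' hG h155u hC K hK hγ I F hbad Kcm h2 s hs c hc ι₀ hι₀ e γK hγK IK φ hφ 𝔞 h𝔞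
      hN𝔞 z hz hη d).𝔣 = Ideal.span {s} * Ideal.span {((F.d : ℕ) : 𝓞 Kcm)} := rfl

/-- `Φ.γK = γK` and `Φ.IK = IK`. [cite: Kato2004Asterisque, Prop. 15.9 (p. 258)] -/
theorem katoGenusFrameOf_γK_IK :
    (katoGenusFrameOf hstar hGZK h159' hE h25 h24i hM1 hM1' hG h155u hC K hK hγ I F hbad Kcm h2 s hs c hc ι₀ hι₀ e γK hγK IK φ hφ 𝔞 h𝔞
      hN𝔞 z hz hη d).γK = γK ∧
    (katoGenusFrameOf hstar hGZK h159' hE h25 h24i hM1 hM1' hG h155u hC K hK hγ I F hbad Kcm h2 s hs c hc ι₀ hι₀ e γK hγK IK φ hφ 𝔞 h𝔞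
      hN𝔞 z hz hη d).IK = IK := ⟨rfl, rfl⟩

/-- `Φ.φ = φ` (D1074: ONE `φ`). [cite: Kato2004Asterisque, (15.16.1) (p. 265)] -/
theorem katoGenusFrameOf_φ :
    (katoGenusFrameOf hstar hGZK h159' hE h25 h24i hM1 hM1' hG h155u hC K hK hγ I F hbad Kcm h2 s hs c hc ι₀ hι₀ e γK hγK IK φ hφ 𝔞 h𝔞
      hN𝔞 z hz hη d).φ = φ := rfl

/-- `Φ.ιC = algClosureEmb ι₀` (D1062). [cite: Kato2004Asterisque, Prop. 15.9 (p. 258)] -/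
theorem katoGenusFrameOf_ιC :
    (katoGenusFrameOf hstar hGZK h159' hE h25 h24i hM1 hM1' hG h155u hC K hK hγ I F hbad Kcm h2 s hs c hc ι₀ hι₀ e γK hγK IK φ hφ 𝔞 h𝔞
      hN𝔞 z hz hη d).ιC = algClosureEmb ι₀ := rfl

/-- `Φ.u = 1`, `Φ.t = 1` (the GIVEN-★ gauge). [cite: Kato2004Asterisque, §15.11 (15.11.3) (pp. 261–262)] -/
theorem katoGenusFrameOf_u_t :
    (katoGenusFrameOf hstar hGZK h159' hE h25 h24i hM1 hM1' hG h155u hC K hK hγ I F hbad Kcm h2 s hs c hc ι₀ hι₀ e γK hγK IK φ hφ 𝔞 h𝔞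
      hN𝔞 z hz hη d).u = 1 ∧
    (katoGenusFrameOf hstar hGZK h159' hE h25 h24i hM1 hM1' hG h155u hC K hK hγ I F hbad Kcm h2 s hs c hc ι₀ hι₀ e γK hγK IK φ hφ 𝔞 h𝔞
      hN𝔞 z hz hη d).t = 1 := ⟨rfl, rfl⟩

/-- `Φ.ψ`, `Φ.Ω`, `Φ.euK` are the Kummer column's. [cite: Kato2004Asterisque, Prop. 15.9 (p. 258)] -/
theorem katoGenusFrameOf_ψ_Ω_euK :
    (katoGenusFrameOf hstar hGZK h159' hE h25 h24i hM1 hM1' hG h155u hC K hK hγ I F hbad Kcm h2 s hs c hc ι₀ hι₀ e γK hγK IK φ hφ 𝔞 h𝔞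
      hN𝔞 z hz hη d).ψ = (kummerColumnDataOf h159' hE h25 h24i hM1 hM1' hG hC K hK F hbad Kcm h2 s hs c hc ι₀ hι₀ γK IK φ hφ).ψ ∧
    (katoGenusFrameOf hstar hGZK h159' hE h25 h24i hM1 hM1' hG h155u hC K hK hγ I F hbad Kcm h2 s hs c hc ι₀ hι₀ e γK hγK IK φ hφ 𝔞 h𝔞
      hN𝔞 z hz hη d).Ω = (kummerColumnDataOf h159' hE h25 h24i hM1 hM1' hG hC K hK F hbad Kcm h2 s hs c hc ι₀ hι₀ γK IK φ hφ).Ω ∧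
    (katoGenusFrameOf hstar hGZK h159' hE h25 h24i hM1 hM1' hG h155u hC K hK hγ I F hbad Kcm h2 s hs c hc ι₀ hι₀ e γK hγK IK φ hφ 𝔞 h𝔞
      hN𝔞 z hz hη d).euK = (kummerColumnDataOf h159' hE h25 h24i hM1 hM1' hG hC K hK F hbad Kcm h2 s hs c hc ι₀ hι₀ γK IK φ hφ).euK :=
  ⟨rfl, rfl, rfl⟩

end Constructor

end Summit.BirchSwinnertonDyer.Rank1Residual.Additive.GenusSeven

end
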